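import Summits.AtomisticToContinuum.FouriersLaw.Theses.LocalOhmBV
import Summits.AtomisticToContinuum.FouriersLaw.Theorems.LocalOhmBVLocalOhmStubSoftExtractionAux1
import Summits.AtomisticToContinuum.FouriersLaw.Theorems.LocalOhmBVLocalOhmStubSoftExtractionAux3
import Summits.AtomisticToContinuum.FouriersLaw.Theorems.LocalOhmBVLocalOhmStubSoftExtractionAux4

/-!
# Stub `stub_softExtraction` (S2c) of the birth line of crux `LocalOhmBV.LocalOhm`

Crux item stmt-AtomisticToContinuum-12009 (`Summit.AtomisticToContinuum.FouriersLaw.Theses.LocalOhmBV.LocalOhm`),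
line `registered` (birth; reshaped by lead c3: S2 split into S2a/S2b/S2c). This file proves the SOFT
EXTRACTION S2c: in the frame of `LocalOhm`, given (A) the interior a-priori estimate (stub S1, as a
hypothesis), the finite-`N` package (conclusion of stub S2a, as a hypothesis), a shift-invariant
infinite-volume Gibbs state `μinf` with the equilibrium / thermodynamic-limit package (clauses of stub
S2b, as hypotheses) and a violating sequence `(N_k, d_k, θ_k, x_k)`, there is a functional `Λ` on
observables of `ChainConfig` which is (1) linear on continuous polynomially bounded cylinder
observables, (2) translation-uniformly `L²(μinf)`-bounded on boxes, (3) annihilates `liouvilleZ` of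
`C¹` polynomially bounded cylinder functions and (4) has unit current on every bond.

Construction (no physics input): `g_k = d_k/(N_k - 1) ≠ 0`; for an observable `F` of the infinite
chain, `F_k = F ∘ embed N_k x_k` (the window re-centred at the violating bulk bond `x_k`);
`Λ_k(F) = (ρ_k(F_k) - θ_k(x_k) · Cov_{Gibbs_{N_k}}(F_k, H_{N_k})/T²)/g_k` with `ρ_k` the response
`limUnder` along `𝓝[≠] 0`; `Λ(F) = limUnder (hyperfilter ℕ) (k ↦ Λ_k(F))`. The level facts are in
the helper files `…StubSoftExtractionAux1` (generalised limits), `…Aux2` (finite-`N` bookkeeping: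
eventual integrability under the perturbed states, linearity of response limits, single-bond current
response, window embedding), `…Aux3` (the level bound from (A) at the re-centred centre `x_k + a`,
`|θ_k(x_k + a) - θ_k(x_k)| ≤ WV_{x_k}(k) < |g_k|/k`, and (b3)), `…Aux4` (level linearity, invariance,
unit current), plus `ne_zero_of_mul_windowVariation_lt` below (`g_k ≠ 0` at a violating level).
Here they are assembled along `hyperfilter ℕ`.
-/

set_option autoImplicit false

noncomputable section

namespace Summit.AtomisticToContinuum.FouriersLaw.Theorems.LocalOhmBirth

open MeasureTheory Filter Topology
open scoped BigOperators
open Literature.MathematicalPhysics.KineticTheory.HeatConduction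
open Summit.AtomisticToContinuum.FouriersLaw.Theorems.WindowLimit (embed)
open Summit.AtomisticToContinuum.FouriersLaw.Theorems.LocalOhmBirth.SoftExtraction

/-- **Non-degeneracy of a violating level**: if `k · WV_x(k) < |d| / r` (the violating inequality of
the blow-up: `k` times the window variation of the kinetic response profile is beaten by the per-bond
current response) then the response coefficient `d` is non-zero, since the window variation is
non-negative. Used to normalise the level functionals by `g_k = d_k/(N_k - 1) ≠ 0`. -/
theorem ne_zero_of_mul_windowVariation_lt :
    ∀ {N : ℕ} (θ : Fin N → ℝ) (x k : ℕ) (d r : ℝ),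
      (k : ℝ) * (∑ i : Fin N, ∑ j : Fin N,
        (if j.val = i.val + 1 ∧ x ≤ i.val + k ∧ i.val ≤ x + k then |θ j - θ i| else 0)) < |d| / r →
      d ≠ 0 := by
  intro N θ x k d r h hd
  rw [hd, abs_zero, zero_div] at h
  exact absurd h (not_lt.2 (mul_nonneg (Nat.cast_nonneg k) (windowVariation_nonneg θ x k)))

/-- **S2c `stub_softExtraction`** (the SOFT extraction of the birth line of `LocalOhmBV.LocalOhm`).
In the frame of `LocalOhm`: the interior estimate (A), the conclusions of S2a (for the frame's
family) and of S2b (for a given shift-invariant Gibbs state `μinf`), and a violating sequence give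
the bad functional `Λ` relative to `μinf`: (1) linear, (2) translation-uniformly `L²(μinf)`-regular,
(3) `liouvilleZ`-invariant, (4) unit current on every bond. Construction: `g_k = d_k/(N_k - 1) ≠ 0`;
`Λ_k(F) = (ρ_k(F ∘ embed N_k x_k) - θ_k(x_k) Cov_{Gibbs_{N_k}}(F ∘ embed N_k x_k, H_{N_k})/T²)/g_k`
(`ρ_k` the response `limUnder`); `Λ = limUnder (hyperfilter ℕ) Λ_k`; (2) from (A) at centre
`x_k + a`, radius `n`, plus `|θ_k(x_k+a) - θ_k(x_k)| ≤ WV_{x_k}(k) < |g_k|/k` and (b3), with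
`‖·‖_{L²(Gibbs_{N_k})} → ‖·‖_{L²(μinf)}` by (b4) for `g²`; (3) from (a3) (quotient `≡ 0`) and
(b2c); (4) from (a4) (`ρ_k(j) = g_k`) and (b2b); (1) from linearity of limits and of `limUnder`
along the ultrafilter on eventually bounded sequences. -/
theorem stub_softExtraction :
    ∀ ω₂ lam β γ : ℝ, 0 < ω₂ → 0 < lam → 0 < β → 0 < γ →
    (∀ (N : ℕ) (T_L T_R : ℝ), 0 < T_L → 0 < T_R → ∀ μ ν : Measure (PhaseSpace N),
      (pinnedChain ω₂ lam β γ).IsSteadyState N T_L T_R μ →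
      (pinnedChain ω₂ lam β γ).IsSteadyState N T_L T_R ν → μ = ν) →
    ∀ μ : (N : ℕ) → ℝ → ℝ → Measure (PhaseSpace N),
    (∀ (N : ℕ) (T_L T_R : ℝ), 0 < T_L → 0 < T_R →
      (pinnedChain ω₂ lam β γ).IsSteadyState N T_L T_R (μ N T_L T_R)) →
    ∀ T : ℝ, 0 < T →
    -- (A) the interior a-priori estimate (S1), verbatim
    (∀ ℓ : ℕ, ∃ (b : ℕ) (A : ℝ), ∀ (N : ℕ) (d : ℝ) (θ : Fin N → ℝ),
      Tendsto (fun δ : ℝ => (pinnedChain ω₂ lam β γ).totalCurrent (μ N (T + δ / 2) (T - δ / 2)) / δ)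
        (𝓝[≠] 0) (𝓝 d) →
      (∀ i : Fin N, Tendsto (fun δ : ℝ => ((∫ x, (x.2 i) ^ 2 ∂(μ N (T + δ / 2) (T - δ / 2))) -
        ∫ x, (x.2 i) ^ 2 ∂(μ N T T)) / δ) (𝓝[≠] 0) (𝓝 (θ i))) →
      ∀ x : ℕ, b + ℓ ≤ x → x + ℓ + b + 2 ≤ N →
      ∀ ψ : PhaseSpace N → ℝ, Continuous ψ →
        (∀ z z' : PhaseSpace N, (∀ i : Fin N, x ≤ i.val + ℓ → i.val ≤ x + ℓ + 1 →
          z.1 i = z'.1 i ∧ z.2 i = z'.2 i) → ψ z = ψ z') →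
        (∃ (C₀ : ℝ) (m : ℕ), ∀ z, |ψ z| ≤ C₀ * (1 + ‖z‖) ^ m) →
        ∀ ρ : ℝ, Tendsto (fun δ : ℝ => ((∫ z, ψ z ∂(μ N (T + δ / 2) (T - δ / 2))) -
          ∫ z, ψ z ∂(μ N T T)) / δ) (𝓝[≠] 0) (𝓝 ρ) →
        |ρ - (∑ i : Fin N, if i.val = x then θ i else 0) *
            (((∫ z, ψ z * (pinnedChain ω₂ lam β γ).hamiltonian N z ∂(μ N T T)) -
              (∫ z, ψ z ∂(μ N T T)) * (∫ z, (pinnedChain ω₂ lam β γ).hamiltonian N z ∂(μ N T T))) /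
              T ^ 2)| ≤
          A * Real.sqrt (∫ z, (ψ z) ^ 2 ∂(μ N T T)) *
            (|d| / ((N : ℝ) - 1) + ∑ i : Fin N, ∑ j : Fin N,
              (if j.val = i.val + 1 ∧ x ≤ i.val + ℓ ∧ i.val ≤ x + ℓ then |θ j - θ i| else 0))) →
    -- (S2a) the finite-`N` package, verbatim the conclusion of `stub_finiteResponsePackage`
    (∀ N : ℕ, 3 ≤ N →
      μ N T T = (pinnedChain ω₂ lam β γ).gibbsMeasure N T ∧
      (∀ ψ : PhaseSpace N → ℝ, Continuous ψ →
        (∃ (C₀ : ℝ) (m : ℕ), ∀ z, |ψ z| ≤ C₀ * (1 + ‖z‖) ^ m) →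
        ∃ ρ : ℝ, Tendsto (fun δ : ℝ => ((∫ z, ψ z ∂(μ N (T + δ / 2) (T - δ / 2))) -
          ∫ z, ψ z ∂(μ N T T)) / δ) (𝓝[≠] 0) (𝓝 ρ)) ∧
      (∀ (T_L T_R : ℝ), 0 < T_L → 0 < T_R → ∀ (a : ℤ) (n c : ℕ), 1 ≤ a + c → a + c + n + 2 ≤ N →
        ∀ G : (Fin (n + 1) → ℝ × ℝ) → ℝ, ContDiff ℝ 1 G →
        (∃ (C₀ : ℝ) (m : ℕ), ∀ y, |G y| ≤ C₀ * (1 + ‖y‖) ^ m ∧ ‖fderiv ℝ G y‖ ≤ C₀ * (1 + ‖y‖) ^ m) →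
        Integrable (fun z => liouvilleZ (pinnedChain ω₂ lam β γ) (G ∘ boxRestrictAt a n) (embed N c z))
            (μ N T_L T_R) ∧
          ∫ z, liouvilleZ (pinnedChain ω₂ lam β γ) (G ∘ boxRestrictAt a n) (embed N c z) ∂(μ N T_L T_R) =
            0) ∧
      (∀ (T_L T_R : ℝ), 0 < T_L → 0 < T_R → ∀ i k : Fin N, i.val + 2 ≤ N → k.val + 2 ≤ N →
        ∫ z, (pinnedChain ω₂ lam β γ).bondCurrent N i z ∂(μ N T_L T_R) =
          ∫ z, (pinnedChain ω₂ lam β γ).bondCurrent N k z ∂(μ N T_L T_R))) →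
    -- (S2b) the equilibrium package for a given shift-invariant Gibbs state `μinf`
    ∀ μinf : Measure ChainConfig, (pinnedChain ω₂ lam β γ).IsChainGibbsMeasure T μinf →
    IsShiftInvariant μinf →
    (∀ (a : ℤ) (n : ℕ) (g : (Fin (n + 1) → ℝ × ℝ) → ℝ), Continuous g →
      (∃ (C₀ : ℝ) (m : ℕ), ∀ y, |g y| ≤ C₀ * (1 + ‖y‖) ^ m) →
      Integrable (fun σ => g (boxRestrictAt a n σ)) μinf) →
    (∀ (N : ℕ) (ψ : PhaseSpace N → ℝ), Continuous ψ →
      (∃ (C₀ : ℝ) (m : ℕ), ∀ z, |ψ z| ≤ C₀ * (1 + ‖z‖) ^ m) →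
      Integrable ψ ((pinnedChain ω₂ lam β γ).gibbsMeasure N T) ∧
        Integrable (fun z => ψ z * (pinnedChain ω₂ lam β γ).hamiltonian N z)
          ((pinnedChain ω₂ lam β γ).gibbsMeasure N T)) →
    (∀ (N : ℕ) (i : Fin N),
      (∫ z, (pinnedChain ω₂ lam β γ).bondCurrent N i z * (pinnedChain ω₂ lam β γ).hamiltonian N z
          ∂((pinnedChain ω₂ lam β γ).gibbsMeasure N T)) -
        (∫ z, (pinnedChain ω₂ lam β γ).bondCurrent N i z ∂((pinnedChain ω₂ lam β γ).gibbsMeasure N T)) *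
          (∫ z, (pinnedChain ω₂ lam β γ).hamiltonian N z ∂((pinnedChain ω₂ lam β γ).gibbsMeasure N T)) =
        0) →
    (∀ (N : ℕ) (a : ℤ) (n c : ℕ), 1 ≤ a + c → a + c + n + 2 ≤ N →
      ∀ G : (Fin (n + 1) → ℝ × ℝ) → ℝ, ContDiff ℝ 1 G →
      (∃ (C₀ : ℝ) (m : ℕ), ∀ y, |G y| ≤ C₀ * (1 + ‖y‖) ^ m ∧ ‖fderiv ℝ G y‖ ≤ C₀ * (1 + ‖y‖) ^ m) →
      (∫ z, liouvilleZ (pinnedChain ω₂ lam β γ) (G ∘ boxRestrictAt a n) (embed N c z) *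
          (pinnedChain ω₂ lam β γ).hamiltonian N z ∂((pinnedChain ω₂ lam β γ).gibbsMeasure N T)) -
        (∫ z, liouvilleZ (pinnedChain ω₂ lam β γ) (G ∘ boxRestrictAt a n) (embed N c z)
            ∂((pinnedChain ω₂ lam β γ).gibbsMeasure N T)) *
          (∫ z, (pinnedChain ω₂ lam β γ).hamiltonian N z ∂((pinnedChain ω₂ lam β γ).gibbsMeasure N T)) =
        0) →
    (∀ n : ℕ, ∃ C : ℝ, ∀ (N c : ℕ) (a : ℤ), 0 ≤ a + c → a + c + n < N →
      ∀ g : (Fin (n + 1) → ℝ × ℝ) → ℝ, Continuous g →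
      (∃ (C₀ : ℝ) (m : ℕ), ∀ y, |g y| ≤ C₀ * (1 + ‖y‖) ^ m) →
      |(∫ z, g (boxRestrictAt a n (embed N c z)) * (pinnedChain ω₂ lam β γ).hamiltonian N z
            ∂((pinnedChain ω₂ lam β γ).gibbsMeasure N T)) -
          (∫ z, g (boxRestrictAt a n (embed N c z)) ∂((pinnedChain ω₂ lam β γ).gibbsMeasure N T)) *
            (∫ z, (pinnedChain ω₂ lam β γ).hamiltonian N z ∂((pinnedChain ω₂ lam β γ).gibbsMeasure N T))| ≤
        C * Real.sqrt (∫ z, (g (boxRestrictAt a n (embed N c z))) ^ 2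
          ∂((pinnedChain ω₂ lam β γ).gibbsMeasure N T))) →
    (∀ (n : ℕ) (g : (Fin (n + 1) → ℝ × ℝ) → ℝ), Continuous g →
      (∃ (C₀ : ℝ) (m : ℕ), ∀ y, |g y| ≤ C₀ * (1 + ‖y‖) ^ m) →
      ∀ ε : ℝ, 0 < ε → ∃ L N₀ : ℕ, ∀ (N c : ℕ) (a : ℤ), N₀ ≤ N → (L : ℤ) ≤ a + c →
        a + c + n + L < N →
        |(∫ z, g (boxRestrictAt a n (embed N c z)) ∂((pinnedChain ω₂ lam β γ).gibbsMeasure N T)) -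
            ∫ σ, g (boxRestrictAt a n σ) ∂μinf| ≤ ε) →
    -- the violating sequence, verbatim
    ∀ (Nk : ℕ → ℕ) (dk : ℕ → ℝ) (θk : (k : ℕ) → Fin (Nk k) → ℝ) (xk : ℕ → ℕ),
    (∀ k : ℕ, Tendsto (fun δ : ℝ =>
        (pinnedChain ω₂ lam β γ).totalCurrent (μ (Nk k) (T + δ / 2) (T - δ / 2)) / δ) (𝓝[≠] 0) (𝓝 (dk k))) →
    (∀ (k : ℕ) (i : Fin (Nk k)), Tendsto (fun δ : ℝ =>
        ((∫ x, (x.2 i) ^ 2 ∂(μ (Nk k) (T + δ / 2) (T - δ / 2))) - ∫ x, (x.2 i) ^ 2 ∂(μ (Nk k) T T)) / δ)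
        (𝓝[≠] 0) (𝓝 (θk k i))) →
    (∀ k : ℕ, k ≤ xk k) → (∀ k : ℕ, xk k + k + 2 ≤ Nk k) →
    (∀ k : ℕ, (k : ℝ) * ∑ i : Fin (Nk k), ∑ j : Fin (Nk k),
        (if j.val = i.val + 1 ∧ xk k ≤ i.val + k ∧ i.val ≤ xk k + k then |θk k j - θk k i| else 0) <
      |dk k| / ((Nk k : ℝ) - 1)) →
    ∃ Λ : (ChainConfig → ℝ) → ℝ,
      (∀ (a : ℤ) (n : ℕ) (c₁ c₂ : ℝ) (g₁ g₂ : (Fin (n + 1) → ℝ × ℝ) → ℝ), Continuous g₁ → Continuous g₂ →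
        (∃ (C₀ : ℝ) (m : ℕ), ∀ y, |g₁ y| ≤ C₀ * (1 + ‖y‖) ^ m ∧ |g₂ y| ≤ C₀ * (1 + ‖y‖) ^ m) →
        Λ ((fun y => c₁ * g₁ y + c₂ * g₂ y) ∘ boxRestrictAt a n) =
          c₁ * Λ (g₁ ∘ boxRestrictAt a n) + c₂ * Λ (g₂ ∘ boxRestrictAt a n)) ∧
      (∀ n : ℕ, ∃ A : ℝ, ∀ (a : ℤ) (g : (Fin (n + 1) → ℝ × ℝ) → ℝ), Continuous g →
        (∃ (C₀ : ℝ) (m : ℕ), ∀ y, |g y| ≤ C₀ * (1 + ‖y‖) ^ m) →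
        |Λ (g ∘ boxRestrictAt a n)| ≤ A * Real.sqrt (∫ σ, (g (boxRestrictAt a n σ)) ^ 2 ∂μinf)) ∧
      (∀ (a : ℤ) (n : ℕ) (G : (Fin (n + 1) → ℝ × ℝ) → ℝ), ContDiff ℝ 1 G →
        (∃ (C₀ : ℝ) (m : ℕ), ∀ y, |G y| ≤ C₀ * (1 + ‖y‖) ^ m ∧ ‖fderiv ℝ G y‖ ≤ C₀ * (1 + ‖y‖) ^ m) →
        Λ (liouvilleZ (pinnedChain ω₂ lam β γ) (G ∘ boxRestrictAt a n)) = 0) ∧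
      (∀ i : ℤ, Λ (fun σ => (pinnedChain ω₂ lam β γ).bondCurrentZ σ i) = 1) := by
  intro ω₂ lam β γ hω hl hβ _hγ _hU μ _hμ T hT hA hS2a μinf _hG _hS _hb1 hb1' hb2b hb2c hb3 hb4 Nk dk
    θk xk hD hΘ hx₁ hx₂ hlt
  -- Gibbs facts of the pinned chain
  have hGprob : ∀ N : ℕ, IsProbabilityMeasure ((pinnedChain ω₂ lam β γ).gibbsMeasure N T) :=
    fun N => pinnedChain_isProbabilityMeasure_gibbsMeasure hω hl.le hβ.le γ N hT
  have hGcur : ∀ (N : ℕ) (i : Fin N), ∫ z, (pinnedChain ω₂ lam β γ).bondCurrent N i z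
      ∂((pinnedChain ω₂ lam β γ).gibbsMeasure N T) = 0 :=
    fun N i => pinnedChain_integral_bondCurrent_gibbsMeasure ω₂ lam β γ N T i
  set P := pinnedChain ω₂ lam β γ with hP
  -- the finite-`N` package, unpacked
  have ha1 : ∀ N : ℕ, 3 ≤ N → μ N T T = P.gibbsMeasure N T := fun N h => (hS2a N h).1
  have ha2 := fun N (h : 3 ≤ N) => (hS2a N h).2.1
  have ha3 := fun N (h : 3 ≤ N) => (hS2a N h).2.2.1
  have ha4 := fun N (h : 3 ≤ N) => (hS2a N h).2.2.2
  -- the normalisation `g_k = d_k/(N_k - 1)` is non-zero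
  have hdk : ∀ k : ℕ, dk k ≠ 0 := fun k =>
    ne_zero_of_mul_windowVariation_lt (θk k) (xk k) k (dk k) _ (hlt k)
  -- the translation-uniform eventual bound of the level functionals (REGULARITY at level `k`)
  have key : ∀ n : ℕ, ∃ A' : ℝ, ∀ (a : ℤ) (g : (Fin (n + 1) → ℝ × ℝ) → ℝ), Continuous g →
      (∃ (C₀ : ℝ) (m : ℕ), ∀ y, |g y| ≤ C₀ * (1 + ‖y‖) ^ m) → ∀ ε : ℝ, 0 < ε →
      ∀ᶠ k in atTop,
        |(limUnder (𝓝[≠] (0 : ℝ)) (fun δ : ℝ =>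
              ((∫ z, g (boxRestrictAt a n (embed (Nk k) (xk k) z))
                  ∂(μ (Nk k) (T + δ / 2) (T - δ / 2))) -
                ∫ z, g (boxRestrictAt a n (embed (Nk k) (xk k) z)) ∂(μ (Nk k) T T)) / δ) -
            (∑ i : Fin (Nk k), if i.val = xk k then θk k i else 0) *
              (((∫ z, g (boxRestrictAt a n (embed (Nk k) (xk k) z)) * P.hamiltonian (Nk k) z
                  ∂(P.gibbsMeasure (Nk k) T)) -
                (∫ z, g (boxRestrictAt a n (embed (Nk k) (xk k) z)) ∂(P.gibbsMeasure (Nk k) T)) *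
                  (∫ z, P.hamiltonian (Nk k) z ∂(P.gibbsMeasure (Nk k) T))) / T ^ 2)) /
            (dk k / ((Nk k : ℝ) - 1))| ≤
          A' * Real.sqrt ((∫ σ, (g (boxRestrictAt a n σ)) ^ 2 ∂μinf) + ε) := by
    intro n
    obtain ⟨b, A, hA'⟩ := hA n
    obtain ⟨C, hC⟩ := hb3 n
    exact ⟨2 * |A| + |C| / T ^ 2, fun a g hg hgb ε hε =>
      eventually_level_bound P μ hT n b A C hA' ha1 ha2 hC hb4 Nk dk θk xk hD hΘ hx₁ hx₂ hlt a g hg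
        hgb ε hε⟩
  -- the functional: generalised limit over `k` of the normalised level functionals
  refine ⟨fun F => limUnder (hyperfilter ℕ : Filter ℕ) (fun k =>
      (limUnder (𝓝[≠] (0 : ℝ)) (fun δ : ℝ =>
          ((∫ z, F (embed (Nk k) (xk k) z) ∂(μ (Nk k) (T + δ / 2) (T - δ / 2))) -
            ∫ z, F (embed (Nk k) (xk k) z) ∂(μ (Nk k) T T)) / δ) -
        (∑ i : Fin (Nk k), if i.val = xk k then θk k i else 0) *
          (((∫ z, F (embed (Nk k) (xk k) z) * P.hamiltonian (Nk k) z ∂(P.gibbsMeasure (Nk k) T)) -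
            (∫ z, F (embed (Nk k) (xk k) z) ∂(P.gibbsMeasure (Nk k) T)) *
              (∫ z, P.hamiltonian (Nk k) z ∂(P.gibbsMeasure (Nk k) T))) / T ^ 2)) /
        (dk k / ((Nk k : ℝ) - 1))), ?_, ?_, ?_, ?_⟩
  · -- (1) linearity: eventual linearity at level `k`, both sequences eventually bounded by `key`
    intro a n c₁ c₂ g₁ g₂ hg₁ hg₂ hgb
    obtain ⟨C₀, m, hC₀⟩ := hgb
    obtain ⟨A', hkey⟩ := key n
    simp only [Function.comp_apply]
    exact hyperfilter_limUnder_linear c₁ c₂ (hkey a g₁ hg₁ ⟨C₀, m, fun y => (hC₀ y).1⟩ 1 one_pos)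
      (hkey a g₂ hg₂ ⟨C₀, m, fun y => (hC₀ y).2⟩ 1 one_pos)
      (eventually_level_linear P μ T hGprob ha1 ha2 hb1' Nk dk θk xk hx₂ a n c₁ c₂ g₁ g₂ hg₁ hg₂
        ⟨C₀, m, fun y => (hC₀ y).1⟩ ⟨C₀, m, fun y => (hC₀ y).2⟩)
  · -- (2) translation-uniform `L²(μinf)` regularity
    intro n
    obtain ⟨A', hkey⟩ := key n
    refine ⟨A', fun a g hg hgb => ?_⟩
    simp only [Function.comp_apply]
    exact le_mul_sqrt_of_forall_pos fun ε hε => hyperfilter_abs_limUnder_le (hkey a g hg hgb ε hε)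
  · -- (3) invariance: the level values vanish eventually
    intro a n G hG hGb
    refine hyperfilter_limUnder_eq_of_eventually_eq ?_
    filter_upwards [eventually_ge_atTop (a.natAbs + n + 3)] with k hk
    have hxk := hx₁ k
    have hNk := hx₂ k
    have hN3 : 3 ≤ Nk k := by omega
    exact level_liouville_eq_zero P (μ (Nk k)) hT _ _ a n (xk k) G
      (fun T_L T_R hL hR =>
        (ha3 (Nk k) hN3 T_L T_R hL hR a n (xk k) (by omega) (by omega) G hG hGb).2)
      (hb2c (Nk k) a n (xk k) (by omega) (by omega) G hG hGb)
  · -- (4) unit current: the level values are `1` eventually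
    intro i
    refine hyperfilter_limUnder_eq_of_eventually_eq ?_
    filter_upwards [eventually_ge_atTop (i.natAbs + 3)] with k hk
    have hxk := hx₁ k
    have hNk := hx₂ k
    have hN3 : 3 ≤ Nk k := by omega
    refine level_current_eq_one P (μ (Nk k)) hT _ (dk k) (xk k) i ⟨(i + xk k).toNat, by omega⟩
      (by simp only; omega) (by simp only; omega) (hD k) (ha4 (Nk k) hN3) ?_ (hb2b (Nk k) _) (hdk k)
    rw [ha1 (Nk k) hN3]
    exact hGcur (Nk k) _

end Summit.AtomisticToContinuum.FouriersLaw.Theorems.LocalOhmBirth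

end
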